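import Summits.HodgeConjecture.HodgeConjecture.Theorems.F0P3GlobalPacket          -- ★ `GlobalPacket 𝔩`, `GlobalPacket.Mem`, ★ `LocalPacketKit` (Finset-valued `mem`), ★ `cmOccursInDiscreteSpectrum`
import Literature.NumberTheory.Rogawski1990.CMLocalAPacketMembers                 -- ★ `Gqs`, ★ `qsForm`
import HarnessLib

/-!
# `K2E1RigidityFiniteU3RPacketReduction` — the repaired socket `sig_K2E1RigidityFiniteU3R` (FINITE FIBRES over a FIXED cofinite pin) REDUCED TO
# MEMBER-LEVEL RIGIDITY inside one global packet; the finiteness itself is the finiteness of local packets (kit-generic, PROVED)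

Track B ∕ K2-LIT, crux h413 = `stmt-HodgeConjecture-24833`, route of record `HCCMUnconditional`; prover seat `hodgecm-mathlib-K2E1-p08` (g0); chair K2-lead RULING R8
(2026-09-03): old socket #8 `sig_K2E1RigidityFiniteU3` is false as typed (★ `K2E1RigidityFiniteU3ParityObstruction`), the repaired socket
`sig_K2E1RigidityFiniteU3R` («for an occurring family `π` of `U(Φ₃)` and every FIXED finite set `S` of finite places, only finitely many occurring `π'` agree
with `π` at every place outside `S`») rides the next edition of `Cruxes/H413/Lines/K2_E1_TraceFormulaBetaSigs_GlobalIndex.lean`.  Lane `--supports stmt-HodgeConjecture-24833`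
(count-neutral).  THEOREMS ONLY (no `def`, no `instance`, no notation, no named-fact hypothesis, no `sorry`); closes no socket.

THE MATHEMATICS [Rogawski1990 §13.3 Thm. 13.3.5 p. 202 «If `Π_v = Π′_v` for almost all `v`, then `Π = Π′`»; Thm. 13.3.6 (c); §13.1 Prop. 13.1.2 (a) p. 198
«`Card(Π) = 1, 2, or 4`»; p. 199 «each representation … lies in at least one packet in `Π′(G)` and in at most one unless `π = πˢ(ξ)`»].  Print's proof of the
repaired socket has two layers, separated here over the tree's CONCRETE packet currency ★ `F0P3GlobalPacket.GlobalPacket 𝔩` (a global packet `Π = ⊗_v Π_v` over ANY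
family `𝔩` of ★ `LocalPacketKit`s, whose local member sets `(𝔩 v).mem (Π.loc v)` are `Finset`s — Prop. 13.1.2 (a) is built into the kit — and whose members
★ `GlobalPacket.Mem` are the families `π_v ∈ Π_v` for all `v`, unramified a.e.):
1. COUNTING (§1–§2, PROVED, kit-generic, any hermitian `H′`): inside ONE global packet `Π`, the members agreeing with a given family `π` off a FIXED finite `S`
   are finitely many — at most `∏_{v ∈ S} Card Π_v` (restriction to `S` is injective on them and lands in a finite product) — `finite_setOf_mem_and_eqOff`;
   and if the local member sets of `Π` are EVENTUALLY THE SINGLETON `{π_v}` (the situation of `Π ∈ Π_e(G) ∪ Π_s(G)`: unramified packets off the finitely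
   many square-integrable places of `ρ` are singletons), then the WHOLE member set of `Π` is finite (`finite_setOf_mem_of_eventually_eq`) and so is the
   cofinite fibre `{π' ∈ Π | π' =ᶠ π}` (`finite_setOf_mem_and_eventuallyEq_of_eventually_eq`) — the formal reason the OLD socket's shape survives off the
   A-packets, where `Card Π(ξ_v) = 2` at every non-split `v` defeats it (★ `K2E1RigidityFiniteU3ParityObstruction`).
2. MEMBER-LEVEL RIGIDITY (§3, the ENGINE's residue, kept as an explicit hypothesis): «every OCCURRING `π'` (★ `cmOccursInDiscreteSpectrum`) agreeing with the
   occurring `π` off `S` is a member of `π`'s packet `Π`» — print: `π'` and `π` lie in discrete packets `Π′, Π` [p. 201]; at a non-split `u ∉ S` they share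
   `π_u`; if `π_u = πⁿ(ξ_u)` both lie in `Π(ξ)` by Thm. 13.3.6 (c) (and `Π(ξ) = Π(ξ′)` by Thm. 13.3.5 ∕ injectivity of `ψ_G`, Thm. 13.2.1); otherwise
   `Π′_u = Π_u` for a.a. `u` («at most one packet unless `πˢ(ξ)`», p. 199) and `Π′ = Π` by Thm. 13.3.5.  Given it, the repaired socket's conclusion at
   `(L, μ, π, S)` is layer 1 (`finite_setOf_occurs_and_eqOff_of_memberRigidity`), and the whole repaired socket follows from the hypothesis quantified over
   `(L, μ, π, S)` (`sig_K2E1RigidityFiniteU3R_of_memberRigidity`, conclusion = the R-socket's type verbatim with the organ's reducible abbrev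
   `Pl L := HeightOneSpectrum (𝓞 L⁺)` inlined).

HONEST LABEL: HC_CM is proved only modulo the 7 printed citations (2 remaining named inputs: hLiu418 = `stmt-HodgeConjecture-24832`, h413 =
`stmt-HodgeConjecture-24833`) until rung 0 closes; this file proves no printed statement — it isolates the engine input (member-level rigidity, Thms. 13.3.5 +
13.3.6 (c)) of one socket and discharges the counting layer.

## References
* [Rogawski1990] J. D. Rogawski, *Automorphic Representations of Unitary Groups in Three Variables*, Ann. of Math. Stud. 123 (1990): §13.1 Prop. 13.1.2 (a) p. 198,
  p. 199; §13.2 Thm. 13.2.1 p. 200; §13.3 p. 201, Thm. 13.3.5 p. 202, Thm. 13.3.6 (c) p. 202; §13.8 p. 219.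
* [FlathCorvallis1979] D. Flath, *Decomposition of representations into tensor products*, Proc. Symp. Pure Math. 33.1 (1979), Thm. 3.
-/

set_option autoImplicit false
-- the mandated namespace repeats the single-problem summit's segment (`HodgeConjecture.HodgeConjecture`)
set_option linter.dupNamespace false

noncomputable section

open NumberField IsDedekindDomain MeasureTheory Filter
open scoped Matrix MatrixGroups
open Literature.NumberTheory.Rogawski1990 Literature.NumberTheory.Automorphic Literature.NumberTheory.Automorphic.UnitaryGroup
open Summit.HodgeConjecture.HodgeConjecture.Cruxes.H413.F0P3LocalPacketKit (LocalPacketKit)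
open Summit.HodgeConjecture.HodgeConjecture.Cruxes.H413.F0P3GlobalPacket (GlobalPacket)
open Summit.HodgeConjecture.HodgeConjecture.Cruxes.H413.F0P3GlobalPacketDiscrete (cmOccursInDiscreteSpectrum)

namespace Summit.HodgeConjecture.HodgeConjecture.Cruxes.H413.K2E1RigidityFiniteU3R

/-! ## §1 Counting: families in a product of finite sets pinned off a finite set -/

/-- **Pure counting.** Families `π'` with `π' a ∈ F a` (finite) for all `a` and `π' a = π a` off the finite set `S` are finitely many: restriction to `S` is injective
on them and lands in the finite product `∏_{a ∈ S} F a`. [folklore] -/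
theorem finite_setOf_forall_mem_and_eqOff {α : Type*} {β : α → Type*} (F : ∀ a, Finset (β a)) (π : ∀ a, β a) (S : Finset α) :
    {π' : ∀ a, β a | (∀ a, π' a ∈ F a) ∧ ∀ a, a ∉ S → π' a = π a}.Finite := by
  classical
  let r : (∀ a, β a) → (∀ a : ↥S, β a.1) := fun π' a => π' a.1
  have hinj : Set.InjOn r {π' : ∀ a, β a | (∀ a, π' a ∈ F a) ∧ ∀ a, a ∉ S → π' a = π a} := by
    intro π₁ h₁ π₂ h₂ heq
    funext a
    by_cases ha : a ∈ S
    · exact congrFun heq ⟨a, ha⟩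
    · rw [h₁.2 a ha, h₂.2 a ha]
  have himg : r '' {π' : ∀ a, β a | (∀ a, π' a ∈ F a) ∧ ∀ a, a ∉ S → π' a = π a} ⊆
      Set.pi Set.univ (fun a : ↥S => (↑(F a.1) : Set (β a.1))) := by
    rintro _ ⟨π', hπ', rfl⟩
    exact fun a _ => hπ'.1 a.1
  exact Set.Finite.of_finite_image ((Set.Finite.pi (fun a : ↥S => (F a.1).finite_toSet)).subset himg) hinj

variable {L : Type} [Field L] [NumberField L] [IsCMField L] {H' : Matrix (Fin 3) (Fin 3) L}
  {𝔩 : ∀ v : HeightOneSpectrum (𝓞 ↥(maximalRealSubfield L)), LocalPacketKit L H' v}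

/-- **FINITE FIBRES OVER A FIXED COFINITE PIN INSIDE ONE GLOBAL PACKET** (kit-generic, any hermitian `H′`): for a global packet `Π` over the kit family `𝔩`
(★ `GlobalPacket`), a family `π` and a finite set `S` of finite places of `L⁺`, the members `π' ∈ Π` (★ `GlobalPacket.Mem`) with `π' u = π u` for all `u ∉ S` are
finitely many (at most `∏_{v ∈ S} Card Π_v`; local packets are finite, Prop. 13.1.2 (a), built into ★ `LocalPacketKit.mem`).
[cite: Rogawski1990, §13.1 Prop. 13.1.2 (a) p. 198; §13.3 p. 201] -/
theorem finite_setOf_mem_and_eqOff (Pg : GlobalPacket 𝔩)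
    (π : ∀ v : HeightOneSpectrum (𝓞 ↥(maximalRealSubfield L)), IrrClass ((UnitaryGroup.cmDatum L 3 H').Local v))
    (S : Finset (HeightOneSpectrum (𝓞 ↥(maximalRealSubfield L)))) :
    {π' : ∀ v : HeightOneSpectrum (𝓞 ↥(maximalRealSubfield L)), IrrClass ((UnitaryGroup.cmDatum L 3 H').Local v) |
      Pg.Mem π' ∧ ∀ u, u ∉ S → π' u = π u}.Finite :=
  (finite_setOf_forall_mem_and_eqOff (fun v => (𝔩 v).mem (Pg.loc v)) π S).subset (fun _ h => ⟨h.1.1, h.2⟩)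

/-! ## §2 Packets whose local member sets are eventually `{π_v}` (the `Π_e ∪ Π_s` situation): the whole member set is finite -/

/-- **If the local member sets of `Π` are EVENTUALLY CONTAINED IN `{π_v}`, the member set of `Π` is finite**: every member agrees with `π` off the finite exceptional
set, and §1 applies.  This is the situation of the endoscopic and stable packets (`Π_v` a singleton at the unramified places off the square-integrable places of
`ρ`); it FAILS for the A-packets `Π(ξ)` (`Card Π(ξ_v) = 2` at every non-split `v`, ★ `K2E1RigidityFiniteU3ParityObstruction`).
[cite: Rogawski1990, §13.1 p. 199; §13.3 p. 201, Thm. 13.3.5 p. 202] -/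
theorem finite_setOf_mem_of_eventually_eq (Pg : GlobalPacket 𝔩)
    (π : ∀ v : HeightOneSpectrum (𝓞 ↥(maximalRealSubfield L)), IrrClass ((UnitaryGroup.cmDatum L 3 H').Local v))
    (h : ∀ᶠ v in Filter.cofinite, ∀ c ∈ (𝔩 v).mem (Pg.loc v), c = π v) :
    {π' : ∀ v : HeightOneSpectrum (𝓞 ↥(maximalRealSubfield L)), IrrClass ((UnitaryGroup.cmDatum L 3 H').Local v) | Pg.Mem π'}.Finite := by
  rw [Filter.eventually_cofinite] at h
  refine (finite_setOf_mem_and_eqOff Pg π h.toFinset).subset (fun π' hπ' => ⟨hπ', fun u hu => ?_⟩)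
  have hu' : ∀ c ∈ (𝔩 u).mem (Pg.loc u), c = π u := by
    by_contra hc
    exact hu (h.mem_toFinset.mpr hc)
  exact hu' (π' u) (hπ'.1 u)

/-- **… hence the COFINITE fibre of the old socket's shape is finite inside such a packet**: `{π' ∈ Π | π' u = π u for cofinitely many u}` is finite when the local
member sets of `Π` are eventually `⊆ {π_v}`. [cite: Rogawski1990, §13.3 p. 201, Thm. 13.3.5 p. 202] -/
theorem finite_setOf_mem_and_eventuallyEq_of_eventually_eq (Pg : GlobalPacket 𝔩)
    (π : ∀ v : HeightOneSpectrum (𝓞 ↥(maximalRealSubfield L)), IrrClass ((UnitaryGroup.cmDatum L 3 H').Local v))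
    (h : ∀ᶠ v in Filter.cofinite, ∀ c ∈ (𝔩 v).mem (Pg.loc v), c = π v) :
    {π' : ∀ v : HeightOneSpectrum (𝓞 ↥(maximalRealSubfield L)), IrrClass ((UnitaryGroup.cmDatum L 3 H').Local v) |
      Pg.Mem π' ∧ ∀ᶠ u in Filter.cofinite, π' u = π u}.Finite :=
  (finite_setOf_mem_of_eventually_eq Pg π h).subset (fun _ hπ' => hπ'.1)

/-! ## §3 The repaired socket from MEMBER-LEVEL RIGIDITY [Thm. 13.3.5 + Thm. 13.3.6 (c)] -/

/-- **FINITE FIBRES over a fixed pin FROM MEMBER-LEVEL RIGIDITY** (any hermitian `H′`, any automorphic-side measure): if every family OCCURRING in the discrete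
spectrum (★ `cmOccursInDiscreteSpectrum`) and agreeing with `π` at all places outside `S` is a member of ONE global packet `Π` (the engine's rigidity: Thm. 13.3.5 +
Thm. 13.3.6 (c) + «at most one packet unless `πˢ(ξ)`»), then those families are finitely many (§1).
[cite: Rogawski1990, §13.3 Thm. 13.3.5 p. 202, Thm. 13.3.6 (c) p. 202; §13.1 p. 199] -/
theorem finite_setOf_occurs_and_eqOff_of_memberRigidity
    (μ : Measure (adelicGroupData (↥(maximalRealSubfield L)) L (IsCMField.complexConj L) 3 H').automorphicQuotient)
    [SMulInvariantMeasure (adelicGroupData (↥(maximalRealSubfield L)) L (IsCMField.complexConj L) 3 H').Adelic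
      (adelicGroupData (↥(maximalRealSubfield L)) L (IsCMField.complexConj L) 3 H').automorphicQuotient μ]
    (π : ∀ v : HeightOneSpectrum (𝓞 ↥(maximalRealSubfield L)), IrrClass ((UnitaryGroup.cmDatum L 3 H').Local v))
    (S : Finset (HeightOneSpectrum (𝓞 ↥(maximalRealSubfield L)))) (Pg : GlobalPacket 𝔩)
    (hrig : ∀ π' : ∀ v : HeightOneSpectrum (𝓞 ↥(maximalRealSubfield L)), IrrClass ((UnitaryGroup.cmDatum L 3 H').Local v),
      cmOccursInDiscreteSpectrum L 3 H' μ π' → (∀ u, u ∉ S → π' u = π u) → Pg.Mem π') :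
    {π' : ∀ v : HeightOneSpectrum (𝓞 ↥(maximalRealSubfield L)), IrrClass ((UnitaryGroup.cmDatum L 3 H').Local v) |
      cmOccursInDiscreteSpectrum L 3 H' μ π' ∧ ∀ u, u ∉ S → π' u = π u}.Finite :=
  (finite_setOf_mem_and_eqOff Pg π S).subset (fun π' h => ⟨hrig π' h.1 h.2, h.2⟩)

/-- **THE REPAIRED SOCKET `sig_K2E1RigidityFiniteU3R` FROM MEMBER-LEVEL RIGIDITY** — for the quasi-split `U(Φ₃)` (`qsForm`, carrier ★ `Gqs L u`): if for every CM `L`,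
automorphic measure `μ`, occurring family `π` and finite set `S` of finite places there is a global packet `Π` over SOME kit family `𝔩` containing every occurring `π'`
that agrees with `π` off `S` (the engine: exhaustion of the discrete spectrum by `Π(G) = Π_s ⊔ Π_e ⊔ Π_a`, p. 201, and rigidity Thms. 13.3.5 ∕ 13.3.6 (c)), then the
repaired socket holds — its type is the conclusion below VERBATIM (organ abbrev `Pl L := HeightOneSpectrum (𝓞 L⁺)` inlined).
[cite: Rogawski1990, §13.3 p. 201, Thm. 13.3.5 p. 202, Thm. 13.3.6 (c) p. 202; §13.1 Prop. 13.1.2 (a) p. 198, p. 199; §13.8 p. 219] [cite: FlathCorvallis1979, Thm. 3] -/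
theorem sig_K2E1RigidityFiniteU3R_of_memberRigidity
    (hRig : ∀ (L : Type) [Field L] [NumberField L] [IsCMField L]
      (μ : Measure (adelicGroupData (↥(maximalRealSubfield L)) L (IsCMField.complexConj L) 3 (qsForm L)).automorphicQuotient)
      [(adelicGroupData (↥(maximalRealSubfield L)) L (IsCMField.complexConj L) 3 (qsForm L)).IsAutomorphicMeasure μ]
      (π : ∀ u : HeightOneSpectrum (𝓞 ↥(maximalRealSubfield L)), IrrClass (Gqs L u)), cmOccursInDiscreteSpectrum L 3 (qsForm L) μ π →
      ∀ S : Finset (HeightOneSpectrum (𝓞 ↥(maximalRealSubfield L))),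
        ∃ (𝔩 : ∀ v : HeightOneSpectrum (𝓞 ↥(maximalRealSubfield L)), LocalPacketKit L (qsForm L) v) (Pg : GlobalPacket 𝔩),
          ∀ π' : ∀ u : HeightOneSpectrum (𝓞 ↥(maximalRealSubfield L)), IrrClass (Gqs L u),
            cmOccursInDiscreteSpectrum L 3 (qsForm L) μ π' → (∀ u, u ∉ S → π' u = π u) → Pg.Mem π') :
    ∀ (L : Type) [Field L] [NumberField L] [IsCMField L]
      (μ : Measure (adelicGroupData (↥(maximalRealSubfield L)) L (IsCMField.complexConj L) 3 (qsForm L)).automorphicQuotient)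
      [(adelicGroupData (↥(maximalRealSubfield L)) L (IsCMField.complexConj L) 3 (qsForm L)).IsAutomorphicMeasure μ]
      (π : ∀ u : HeightOneSpectrum (𝓞 ↥(maximalRealSubfield L)), IrrClass (Gqs L u)), cmOccursInDiscreteSpectrum L 3 (qsForm L) μ π →
      ∀ S : Finset (HeightOneSpectrum (𝓞 ↥(maximalRealSubfield L))),
        {π' : ∀ u : HeightOneSpectrum (𝓞 ↥(maximalRealSubfield L)), IrrClass (Gqs L u) |
          cmOccursInDiscreteSpectrum L 3 (qsForm L) μ π' ∧ ∀ u : HeightOneSpectrum (𝓞 ↥(maximalRealSubfield L)), u ∉ S → π' u = π u}.Finite := by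
  intro L _ _ _ μ _ π hπ S
  obtain ⟨𝔩, Pg, hrig⟩ := hRig L μ π hπ S
  exact finite_setOf_occurs_and_eqOff_of_memberRigidity μ π S Pg hrig

/-! ## §4 (APPEND 1) The converse: with a FREE kit, member-level rigidity is EQUIVALENT to the repaired socket — a substantive rigidity socket must PIN the kit

★ `LocalPacketKit` carries DATA and no laws, so `∃ 𝔩 Π, …` in §3 may be witnessed by an AD-HOC kit: one packet per place whose member set at `v` is `{π_v} ∪ {π'_v : π'
in the (finite) fibre}`, `unr := True`, `sph := π_v`.  Hence FINITE FIBRES ⇒ free-kit member rigidity (`memberRigidity_of_finite`), and the hypothesis of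
`sig_K2E1RigidityFiniteU3R_of_memberRigidity` is LOGICALLY EQUIVALENT to the repaired socket (`sig_K2E1RigidityFiniteU3R_iff_memberRigidity`).  Reading: §3 is the
SHAPE of the close, not a weakening of the debt; an engine socket «member-level rigidity» is stronger than #8R only when stated over the ENGINE's kit (the family
carrying the laws ★ `LocalPacketKit.CardLaw` ∕ the character identities ∕ the e.v.p. data — Rogawski's `Π′(G_v)`), not over `∃ 𝔩`. -/

/-- **FINITE FIBRES ⇒ FREE-KIT MEMBER RIGIDITY** (any hermitian `H′`): if the occurring families agreeing with `π` off `S` are finitely many, an ad-hoc kit family (one packet per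
place, members `{π_v} ∪` the fibre's `v`-components, every packet «unramified» with spherical member `π_v`) and its unique global packet contain them all as members.
[cite: Rogawski1990, §13.3 p. 201; §13.1 Prop. 13.1.2 (a) p. 198] -/
theorem memberRigidity_of_finite
    (μ : Measure (adelicGroupData (↥(maximalRealSubfield L)) L (IsCMField.complexConj L) 3 H').automorphicQuotient)
    [SMulInvariantMeasure (adelicGroupData (↥(maximalRealSubfield L)) L (IsCMField.complexConj L) 3 H').Adelic
      (adelicGroupData (↥(maximalRealSubfield L)) L (IsCMField.complexConj L) 3 H').automorphicQuotient μ]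
    (π : ∀ v : HeightOneSpectrum (𝓞 ↥(maximalRealSubfield L)), IrrClass ((UnitaryGroup.cmDatum L 3 H').Local v))
    (S : Finset (HeightOneSpectrum (𝓞 ↥(maximalRealSubfield L))))
    (hfin : {π' : ∀ v : HeightOneSpectrum (𝓞 ↥(maximalRealSubfield L)), IrrClass ((UnitaryGroup.cmDatum L 3 H').Local v) |
      cmOccursInDiscreteSpectrum L 3 H' μ π' ∧ ∀ u, u ∉ S → π' u = π u}.Finite) :
    ∃ (𝔩' : ∀ v : HeightOneSpectrum (𝓞 ↥(maximalRealSubfield L)), LocalPacketKit L H' v) (Pg : GlobalPacket 𝔩'),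
      ∀ π' : ∀ v : HeightOneSpectrum (𝓞 ↥(maximalRealSubfield L)), IrrClass ((UnitaryGroup.cmDatum L 3 H').Local v),
        cmOccursInDiscreteSpectrum L 3 H' μ π' → (∀ u, u ∉ S → π' u = π u) → Pg.Mem π' := by
  classical
  refine ⟨fun v =>
    { Pkt := Unit
      mem := fun _ => insert (π v) (hfin.toFinset.image (fun π' => π' v))
      one := fun _ _ => 1
      PktH := PEmpty
      memH := fun e => nomatch e
      regH := fun e => nomatch e
      xiH := fun e => nomatch e
      pair := fun e => nomatch e
      unr := fun _ => True
      sph := fun _ _ => π v }, ⟨fun _ => (), Filter.Eventually.of_forall (fun _ => trivial)⟩, fun π' hocc hoff => ⟨fun v => ?_, ?_⟩⟩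
  · show π' v ∈ insert (π v) (hfin.toFinset.image (fun π'' => π'' v))
    exact Finset.mem_insert_of_mem (Finset.mem_image.mpr ⟨π', hfin.mem_toFinset.mpr ⟨hocc, hoff⟩, rfl⟩)
  · show ∀ᶠ v in Filter.cofinite, ∃ _ : True, π' v = π v
    rw [Filter.eventually_cofinite]
    exact S.finite_toSet.subset (fun v hv => by
      by_contra hvS
      exact hv ⟨trivial, hoff v hvS⟩)

/-- **THE REPAIRED SOCKET ⟺ FREE-KIT MEMBER RIGIDITY** (quasi-split `U(Φ₃)`): the two `Prop`s — the type of `sig_K2E1RigidityFiniteU3R` (verbatim, `Pl` inlined) and the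
hypothesis of `sig_K2E1RigidityFiniteU3R_of_memberRigidity` — are equivalent.  So the engine's deliverable for #8R is member rigidity OVER ITS OWN (law-abiding) kit; the
`∃ 𝔩` form is only the shape of the close. [cite: Rogawski1990, §13.3 Thm. 13.3.5 p. 202; §13.1 p. 199] -/
theorem sig_K2E1RigidityFiniteU3R_iff_memberRigidity :
    (∀ (L : Type) [Field L] [NumberField L] [IsCMField L]
      (μ : Measure (adelicGroupData (↥(maximalRealSubfield L)) L (IsCMField.complexConj L) 3 (qsForm L)).automorphicQuotient)
      [(adelicGroupData (↥(maximalRealSubfield L)) L (IsCMField.complexConj L) 3 (qsForm L)).IsAutomorphicMeasure μ]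
      (π : ∀ u : HeightOneSpectrum (𝓞 ↥(maximalRealSubfield L)), IrrClass (Gqs L u)), cmOccursInDiscreteSpectrum L 3 (qsForm L) μ π →
      ∀ S : Finset (HeightOneSpectrum (𝓞 ↥(maximalRealSubfield L))),
        {π' : ∀ u : HeightOneSpectrum (𝓞 ↥(maximalRealSubfield L)), IrrClass (Gqs L u) |
          cmOccursInDiscreteSpectrum L 3 (qsForm L) μ π' ∧ ∀ u : HeightOneSpectrum (𝓞 ↥(maximalRealSubfield L)), u ∉ S → π' u = π u}.Finite) ↔
    (∀ (L : Type) [Field L] [NumberField L] [IsCMField L]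
      (μ : Measure (adelicGroupData (↥(maximalRealSubfield L)) L (IsCMField.complexConj L) 3 (qsForm L)).automorphicQuotient)
      [(adelicGroupData (↥(maximalRealSubfield L)) L (IsCMField.complexConj L) 3 (qsForm L)).IsAutomorphicMeasure μ]
      (π : ∀ u : HeightOneSpectrum (𝓞 ↥(maximalRealSubfield L)), IrrClass (Gqs L u)), cmOccursInDiscreteSpectrum L 3 (qsForm L) μ π →
      ∀ S : Finset (HeightOneSpectrum (𝓞 ↥(maximalRealSubfield L))),
        ∃ (𝔩' : ∀ v : HeightOneSpectrum (𝓞 ↥(maximalRealSubfield L)), LocalPacketKit L (qsForm L) v) (Pg : GlobalPacket 𝔩'),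
          ∀ π' : ∀ u : HeightOneSpectrum (𝓞 ↥(maximalRealSubfield L)), IrrClass (Gqs L u),
            cmOccursInDiscreteSpectrum L 3 (qsForm L) μ π' → (∀ u, u ∉ S → π' u = π u) → Pg.Mem π') := by
  constructor
  · intro h L _ _ _ μ _ π hπ S
    exact memberRigidity_of_finite μ π S (h L μ π hπ S)
  · exact sig_K2E1RigidityFiniteU3R_of_memberRigidity

end Summit.HodgeConjecture.HodgeConjecture.Cruxes.H413.K2E1RigidityFiniteU3R

end
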